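import Literature.NumberTheory.EllipticCurves.ZpExtensionEisensteinSelmerTowerCompatProofs
import Literature.NumberTheory.GaloisCohomology.ArchimedeanInvariantMap
import HarnessLib

/-!
# `H¹(K_w, M) = 0` at a complex place; `cond_red` for Howard's `F_𝔮` at the complex places
# (theorems only; no definition, no named fact, no instance)

Topic `NumberTheory/EllipticCurves` (D1 road of cell `pub/bsd-print-x9`; companion of
`ZpExtensionEisensteinSelmerTowerCompatProofs`). Howard [arXiv 1202.6340, H.4 p. 7 and §1.6]: `K` is imaginary
quadratic, so its only infinite place is complex, `Γ_{K_w}` is trivial and `H¹(K_w, T) = 0` — every archimedean clause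
of his hypotheses is automatic. In the tree `Γ_{K_w} = 1` at a complex place is
`GaloisCohomology.eq_one_absoluteGaloisGroup_of_isComplex` (file `ArchimedeanInvariantMap`); here:

* `galoisCohomology.eq_zero_of_isComplex` — every class of `H¹(K_w, M)` (any discrete `Γ_K`-module `M`, `w` complex)
  vanishes (a continuous crossed homomorphism on the trivial group is zero);
* `ZpExtension.map_red_eisensteinSelmerStructure_eq_inl_of_isComplex` — the `DVRSetting.SatisfiesH.cond_red`
  EQUALITY for Howard's `F_𝔮` at a complex place `w` (both sides are subgroups of the zero group; `F_𝔮` is `⊤` there);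
  `…_eq_inl_of_isTotallyComplex` — at every infinite place of a totally complex `K` (e.g. imaginary quadratic).

So for `K` imaginary quadratic the residual of `cond_red` for the D1 tower is ONLY the finite places outside
`S ∪ {v ∣ p}` (surjectivity of `H¹_ur` along an unramified tower). Theorems only; no `sorry`. BSD is not proved.

References: [Howard2004HeegnerKolyvagin] H.4 (arXiv p. 7) and §1.6; [SerreGaloisCohomology1997] I §2.2, §2.4.
-/

noncomputable section

open scoped TensorProduct ContRepresentation
open Field IsLocalRing IsDedekindDomain
open scoped NumberField

universe u

namespace Literature.NumberTheory.GaloisRepresentations.galoisCohomology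

variable {K : Type u} [Field K] [NumberField K] {M : Type u} [AddCommGroup M] [TopologicalSpace M]
  [DiscreteTopology M] (ρ : DiscreteGaloisModule K M)

/-- **`H¹(K_w, M) = 0` at a complex place**: `Γ_{K_w} = 1` (`eq_one_absoluteGaloisGroup_of_isComplex`), and a
continuous crossed homomorphism vanishes at `1`. [cite: SerreGaloisCohomology1997, Ch. I §2.2 and §5.1] [cite: Howard2004HeegnerKolyvagin, H.4 (arXiv p. 7: K imaginary quadratic, the archimedean clause is vacuous)] -/
theorem eq_zero_of_isComplex {w : NumberField.InfinitePlace K} (hw : w.IsComplex)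
    (x : galoisCohomology (ρ.toLocal (Sum.inl w)) 1) : x = 0 := by
  obtain ⟨φ, rfl⟩ := oneCocycleClass_surjective (ρ.toLocal (Sum.inl w)).toTopRep x
  have hφ : φ = 0 := Subtype.ext (ContinuousMap.ext fun σ ↦ by
    rw [Literature.NumberTheory.GaloisCohomology.eq_one_absoluteGaloisGroup_of_isComplex hw σ]
    exact contOneCocycles.apply_one φ)
  rw [hφ, ← sub_self φ, oneCocycleClass_sub]
  exact sub_self _

/-- Hence every subgroup of `H¹(K_w, M)` at a complex place is `⊤` (and `⊥`).
[cite: SerreGaloisCohomology1997, Ch. I §2.2] -/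
theorem addSubgroup_eq_top_of_isComplex {w : NumberField.InfinitePlace K} (hw : w.IsComplex)
    (L : AddSubgroup (galoisCohomology (ρ.toLocal (Sum.inl w)) 1)) : L = ⊤ := by
  refine eq_top_iff.2 fun x _ ↦ ?_
  rw [eq_zero_of_isComplex ρ hw x]
  exact zero_mem L

end Literature.NumberTheory.GaloisRepresentations.galoisCohomology

namespace Literature.NumberTheory.EllipticCurves.ZpExtension

open Literature.NumberTheory.GaloisRepresentations
open Literature.NumberTheory.GaloisCohomology.Howard2004

variable {K : Type} [Field K] [NumberField K] {p : ℕ} [hp : Fact p.Prime] (κ : ZpExtension K p)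
  {M : ℕ → Type} [∀ k, AddCommGroup (M k)] [∀ k, TopologicalSpace (M k)] [∀ k, DiscreteTopology (M k)]
  (ρ : ∀ k, DiscreteGaloisModule K (M k))
  (t : ∀ k, (ρ (k + 1)).toContRepresentation →ⁱL (ρ k).toContRepresentation)
  {m : ℕ} (hm : 1 ≤ m) (ht : ∀ k, Function.Surjective (t k))
  (S : Finset (HeightOneSpectrum (𝓞 K)))
  (Φ : ∀ v : HeightOneSpectrum (𝓞 K), ((p : ℕ) : 𝓞 K) ∈ v.asIdeal → OrdinaryFiltration ρ t v)

/-- **`cond_red` for `F_𝔮` at a COMPLEX place, with equality**: both sides are subgroups of `H¹(K_w, ·) = 0`.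
[cite: Howard2004HeegnerKolyvagin, §1.6 and H.4 (arXiv pp. 7, 12)] -/
theorem map_red_eisensteinSelmerStructure_eq_inl_of_isComplex (k : ℕ) {w : NumberField.InfinitePlace K}
    (hw : w.IsComplex) :
    letI := IwasawaAlgebra.isLocalRing_quotient_X_pow_add_C p hm
    (κ.eisensteinSelmerStructure ρ t hm S Φ (k + 1) (Sum.inl w)).map
        (ContinuousRep.cohomologyMap (((κ.eisensteinAdicTower ρ t hm ht).ρ (k + 1)).toLocal (Sum.inl w))
          (((κ.eisensteinAdicTower ρ t hm ht).ρ k).toLocal (Sum.inl w))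
          ((κ.eisensteinAdicTower ρ t hm ht).red k).toAddMonoidHom continuous_of_discreteTopology
          (fun _ x ↦ (κ.eisensteinAdicTower ρ t hm ht).red_equivariant k _ x) 1) =
      κ.eisensteinSelmerStructure ρ t hm S Φ k (Sum.inl w) := by
  letI := IwasawaAlgebra.isLocalRing_quotient_X_pow_add_C p hm
  rw [galoisCohomology.addSubgroup_eq_top_of_isComplex (κ.eisensteinTwist (ρ k) hm k) hw
      (κ.eisensteinSelmerStructure ρ t hm S Φ k (Sum.inl w))]
  exact galoisCohomology.addSubgroup_eq_top_of_isComplex (κ.eisensteinTwist (ρ k) hm k) hw _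

/-- **`cond_red` for `F_𝔮` at every infinite place of a TOTALLY COMPLEX field** (e.g. `K` imaginary quadratic, the
setting of Howard 2004), with equality. [cite: Howard2004HeegnerKolyvagin, §1.6 and H.4 (arXiv pp. 7, 12)] -/
theorem map_red_eisensteinSelmerStructure_eq_inl_of_isTotallyComplex [NumberField.IsTotallyComplex K] (k : ℕ)
    (w : NumberField.InfinitePlace K) :
    letI := IwasawaAlgebra.isLocalRing_quotient_X_pow_add_C p hm
    (κ.eisensteinSelmerStructure ρ t hm S Φ (k + 1) (Sum.inl w)).map
        (ContinuousRep.cohomologyMap (((κ.eisensteinAdicTower ρ t hm ht).ρ (k + 1)).toLocal (Sum.inl w))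
          (((κ.eisensteinAdicTower ρ t hm ht).ρ k).toLocal (Sum.inl w))
          ((κ.eisensteinAdicTower ρ t hm ht).red k).toAddMonoidHom continuous_of_discreteTopology
          (fun _ x ↦ (κ.eisensteinAdicTower ρ t hm ht).red_equivariant k _ x) 1) =
      κ.eisensteinSelmerStructure ρ t hm S Φ k (Sum.inl w) :=
  κ.map_red_eisensteinSelmerStructure_eq_inl_of_isComplex ρ t hm ht S Φ k
    (NumberField.IsTotallyComplex.isComplex w)

end Literature.NumberTheory.EllipticCurves.ZpExtension

end
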